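import Mathlib.Algebra.Order.Chebyshev
import Literature.NumberTheory.LFunctions.GaussianPrimesInSectors
import HarnessLib

/-!
# Mean value theorems for Hecke polynomials of `ℤ[i]` (Harman 2007, Lemma 11.1–11.2;
# Järviniemi–Teräväinen 2024, Lemmas 3.2–3.3) as named facts

Topic `Literature/NumberTheory/LFunctions`, next to `GaussianPrimesInSectors.lean` (whose
vocabulary `normLE`, `firstQuadrant`, `angularChar` is reused). Filed for work item `wi-17685`
(route `Parity/NeedleSectors`, crux `SectorMobiusMeanSquare`: the Hecke-polynomial path to the
mean square of `μ ∘ N` over Gaussian integers in narrow sectors).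

## Sources (read)

* O. Järviniemi, J. Teräväinen, *Gaussian almost primes in almost all narrow sectors*,
  Rev. Mat. Iberoam. 40 (2024) 1293–1350 = arXiv:2303.05822 [JarviniemiTeravainen2024] — held,
  arXiv text; §1.3 (Notation), Lemma 3.2, Lemma 3.3 with its proof.
* G. Harman, *Prime-Detecting Sieves*, LMS Monographs 33 (2007) [Harman2007] — held; Ch. 11,
  §11.4, Lemma 11.1 (PDF p. 205, "a dual form of the large sieve for `ℤ[i]`", proof in §A.3,
  PDF pp. 291–292, "stated as Lemma 6 in [24]" = Coleman) and Lemma 11.2 (PDF p. 205,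
  "elementary lemma whose proof we leave to the reader").

## Notation (JT §1.3; Harman p. 200, p. 204)

* `ℤ[i]* = {n ≠ 0 : 0 ≤ arg n < π/2}` (JT (1.1)) = the accepted `firstQuadrant`
  (`mem_firstQuadrant_iff_arg`); all sums over `n` run over `ℤ[i]*` (JT Convention 1.4).
  `normLEStar N` below is the finite set `{n ∈ ℤ[i]* : N(n) ≤ N}`.
* `λ^m(n) = (n/|n|)^{4m}`, `m ∈ ℤ` (JT §1.3; Harman p. 204): `angularCharZ m n`, extending the
  accepted `angularChar` (`m ∈ ℕ`) — `angularCharZ_natCast`, and `λ^{-m} = conj λ^m`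
  (`angularCharZ_neg`). Mean values run over `|m| ≤ T`, i.e. `m ∈ [-T, T] ∩ ℤ`.
* Hecke polynomial `F(m) = ∑_{N(n) ≤ N} a_n λ^m(n)`: `heckeSum N a m`.
* `a_n' = ∑_{N(v) ≤ N, arg v = arg n} a_v` (JT (3.1); Harman's `c₁(n)`): `rayCoeff N a n`.
* primitive Gaussian integer `a + bi ∈ ℤ[i]*`, `(a, b) = 1` (JT after (3.1); Harman p. 205):
  `IsPrimitive`. `∑'` = sum over primitive `n` only.
* `τ(n)` = the number of `d ∈ ℤ[i]*` dividing `n` (JT §1.3) — only mentioned (misprint section), not defined here.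
* `|arg n₁ - arg n₂| ≤ 1/T` with `arg` taken modulo `π/2` (JT §1.3 and the remark after
  Lemma 3.3): `ArgClose T n₁ n₂ := ∃ k : ℤ, |arg n₁ - arg n₂ - k π/2| ≤ 1/T`.
* `N, T ≥ 1`: `N : ℝ`, and `T : ℕ` (the sums over `|m| ≤ T` and the bounds `≪ (N + T)·…`,
  `≪ T·…` only see `⌊T⌋`, so real `T` reduces to this case at once).
* `≪` with an absolute implied constant is rendered `∃ C, ∀ …, LHS ≤ C · RHS`.

## Contents

* `JarviniemiTeravainen2024_heckeMVT` — JT **Lemma 3.2, first display** = Harman **Lemma 11.1**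
  extended from `1 ≤ m ≤ T` to `|m| ≤ T` (as JT print it; `|F(-m)|` is `|F(m)|` for the conjugate
  coefficients and the `m = 0` term is `|∑' a_n'|² ≤ #{primitive n} · ∑'|a_n'|²`):
  `∑_{|m| ≤ T} |F(m)|² ≪ (N + T) ∑'_{N(n) ≤ N} |a_n'|²`. Named fact.
* `JarviniemiTeravainen2024_heckeIMVT` — JT **Lemma 3.3** (improved mean value theorem):
  `∑_{|m| ≤ T} |F(m)|² ≪ T ∑ |a_n|² + T ∑_{n₁ ≠ n₂, |arg n₁ - arg n₂| ≤ 1/T} |a_{n₁} a_{n₂}|`.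
  Named fact (its half-page proof — a Fejér-type kernel `g(x) = max(1 - 10T‖x‖, 0)` with
  nonnegative Fourier coefficients `≫ 1/T` on `|m| ≤ T` — is printed in full in JT; not attempted
  here).
* PROVED (section `Ray`): the ray lemma `eq_natCast_mul_of_arg_eq` (a point of `ℤ[i]*` with the
  argument of a primitive `n` is `k n`, `k ∈ ℕ⁺`), the ray count `card_rayStar_le`
  (`#{v : N(v) ≤ N, arg v = arg n} ≤ √(N/N(n))`), and the **ray-sum inequality**
  `sum_norm_rayCoeff_sq_le`: `∑' |a_n'|² ≤ ∑_v |a_v|² g(v) √(N/N(v))`, `g(v) = gcd(re v, im v)` —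
  the correct general form of the bound both sources misprint (next section); its
  primitive-support case `sum_norm_rayCoeff_sq_le_of_primitive`; and the combination with the MVT,
  `JarviniemiTeravainen2024_heckeMVT.le_content_weighted`.
* Harman's Lemma 11.2 second display (divisor-bounded coefficients ⇒ `∑' |c₁(n)|² ≪ N (log N)^C`)
  is true but NOT vendored as a further fact: it follows from `sum_norm_rayCoeff_sq_le` and
  lattice-point counting, which is left to the consumer (debt discipline, D-0026).

## A misprint NOT vendored (JT Lemma 3.2, second display = Harman Lemma 11.2, first display)

Both sources also print the GENERAL bound `∑'_{N(n) ≤ N} |a_n'|² ≪ N ∑_{N(n) ≤ N} |a_n|² τ(n)/N(n)`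
(Harman: proof "left to the reader"; JT: "See [Harman]"). As printed, for arbitrary complex
coefficients (indeed for coefficients bounded by `1`), it is false: take `N = K²` and `a_v = 1` for the rational integers `v = k`,
`K/2 < k ≤ K` (elements of `ℤ[i]*` of argument `0`), `a_v = 0` otherwise. The only primitive `n`
on that ray is `n = 1`, `a_1' = #{K/2 < k ≤ K} ≥ K/2 - 1`, so the left side is `≥ (K/2 - 1)² ≍ N`,
while the right side is `N ∑_{K/2 < k ≤ K} τ(k)/k² ≤ N · max_{k ≤ K} τ(k) · (2/K + 4/K²) = K^{1+o(1)}
= N^{1/2 + o(1)}`. (Harman's "in particular" clause — divisor-bounded coefficients ⇒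
`≪ N (log N)^C` — is unaffected and is what both books actually use.) The correct general
inequality obtained from Cauchy–Schwarz along rays is
`∑' |a_n'|² ≤ ∑_v |a_v|² · g(v) √(N/N(v))`, `g(v) = gcd(re v, im v)` (the ray of a primitive `n`
is `{k n : k ∈ ℕ⁺}` and `v = g(v) · v₀` with `v₀` primitive is the unique such factorisation); it
is PROVED below (`sum_norm_rayCoeff_sq_le`). For primitive `v` the weight is `√(N/N(v)) ≤ N/N(v)`,
so the printed bound does hold for coefficients supported on primitive points
(`sum_norm_rayCoeff_sq_le_of_primitive`); the misprint only bites through points of large content,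
e.g. the inert rational primes `p ≡ 3 (mod 4)` on the real axis.

## Mathlib / tree search

`normLE`, `firstQuadrant`, `angularChar`, `mem_firstQuadrant_iff_arg` (tree, reused);
`Complex.arg`, `Complex.arg_eq_arg_iff`, `Complex.arg_real_mul`, `zpow`, `Int.gcd`,
`Int.gcd_eq_gcd_ab` (Bézout), `sq_sum_le_card_mul_sum_sq` (Cauchy–Schwarz), `Finset.filter/sum`,
`Finset.sum_comm`, `Finset.card_le_one` (Mathlib, used); no large sieve /
mean value theorem for Dirichlet or Hecke polynomials in Mathlib or the tree (`lean search`
"largeSieve", "meanValue.*Dirichlet", "heckePoly": nothing relevant; `HeckePolynomial` in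
`Literature.NumberTheory.Automorphic` is the unrelated local Hecke polynomial at a place).
-/

noncomputable section

open Complex Finset
open scoped Real ComplexConjugate

namespace Literature.NumberTheory.LFunctions.GaussianInt

/-! ### Vocabulary -/

open Classical in
/-- `{n ∈ ℤ[i]* : N(n) ≤ N}`: the Gaussian integers of the first quadrant (`0 < re`, `0 ≤ im`,
Harman's / JT's `ℤ[i]*`) with norm at most `N` — the index set of all sums "over `n`" in JT
(Convention 1.4). [cite: JarviniemiTeravainen2024, §1.3 Convention 1.4 and (1.1)] -/
def normLEStar (N : ℝ) : Finset GaussianInt :=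
  (normLE N).filter fun n => n ∈ firstQuadrant

open Classical in
/-- Membership in `normLEStar N`. [folklore] -/
theorem mem_normLEStar {N : ℝ} {n : GaussianInt} :
    n ∈ normLEStar N ↔ (n.norm : ℝ) ≤ N ∧ n ∈ firstQuadrant := by
  simp [normLEStar, mem_normLE]

/-- Elements of `ℤ[i]*` are nonzero. [folklore] -/
theorem ne_zero_of_mem_firstQuadrant {n : GaussianInt} (h : n ∈ firstQuadrant) : n ≠ 0 := by
  rintro rfl
  exact (lt_irrefl (0 : ℤ)) (by simpa using h.1)

/-- The Hecke angular character `λ^m(n) = (n/|n|)^{4m}` for INTEGER `m` (JT §1.3; Harman p. 204),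
extending the accepted `angularChar` (`m ∈ ℕ`) by `zpow`; `λ^{-m} = conj λ^m`
(`angularCharZ_neg`). Value at `n = 0`: `1` for `m = 0` and `0` otherwise (never used: sums run
over `ℤ[i]*`). [cite: JarviniemiTeravainen2024, §1.3] -/
def angularCharZ (m : ℤ) (z : GaussianInt) : ℂ :=
  ((z : ℂ) / (‖(z : ℂ)‖ : ℂ)) ^ (4 * m)

/-- Unfolding `angularCharZ`. [cite: JarviniemiTeravainen2024, §1.3] -/
theorem angularCharZ_def (m : ℤ) (z : GaussianInt) :
    angularCharZ m z = ((z : ℂ) / (‖(z : ℂ)‖ : ℂ)) ^ (4 * m) := rfl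

/-- For `m ∈ ℕ` the integer-indexed character is the accepted `angularChar`. [folklore] -/
@[simp] theorem angularCharZ_natCast (m : ℕ) (z : GaussianInt) :
    angularCharZ m z = angularChar m z := by
  rw [angularCharZ, angularChar, show (4 * (m : ℤ)) = ((4 * m : ℕ) : ℤ) by push_cast; ring,
    zpow_natCast]

/-- `λ^0 = 1`. [folklore] -/
@[simp] theorem angularCharZ_zero_left (z : GaussianInt) : angularCharZ 0 z = 1 := by
  simp [angularCharZ]

/-- The unit vector `n/|n|` has conjugate equal to its inverse. [folklore] -/
theorem conj_div_norm_eq_inv (w : ℂ) : conj (w / (‖w‖ : ℂ)) = (w / (‖w‖ : ℂ))⁻¹ := by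
  rcases eq_or_ne w 0 with rfl | hw
  · simp
  · have h1 : ‖w / (‖w‖ : ℂ)‖ = 1 := by
      rw [norm_div, Complex.norm_real, Real.norm_eq_abs, abs_norm,
        div_self (norm_ne_zero_iff.mpr hw)]
    rw [Complex.inv_def, Complex.normSq_eq_norm_sq, h1]
    simp

/-- `λ^{-m}(n) = conj (λ^m(n))` (for every `n`, including the junk value at `0`). [folklore] -/
theorem angularCharZ_neg (m : ℤ) (z : GaussianInt) :
    angularCharZ (-m) z = conj (angularCharZ m z) := by
  rw [angularCharZ, angularCharZ, map_zpow₀, conj_div_norm_eq_inv, inv_zpow', mul_neg]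

/-- `|λ^m(n)| = 1` for `n ≠ 0`. [folklore] -/
theorem norm_angularCharZ {m : ℤ} {z : GaussianInt} (hz : z ≠ 0) : ‖angularCharZ m z‖ = 1 := by
  have hz' : (z : ℂ) ≠ 0 := by rwa [Ne, GaussianInt.toComplex_eq_zero]
  have h1 : ‖(z : ℂ) / (‖(z : ℂ)‖ : ℂ)‖ = 1 := by
    rw [norm_div, Complex.norm_real, Real.norm_eq_abs, abs_norm, div_self (norm_ne_zero_iff.mpr hz')]
  rw [angularCharZ, norm_zpow, h1, one_zpow]

/-- The **Hecke polynomial** `F(m) = ∑_{n ∈ ℤ[i]*, N(n) ≤ N} a_n λ^m(n)` at `m ∈ ℤ`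
(JT §3.1; Harman (11.4.1)). [cite: JarviniemiTeravainen2024, Lemma 3.2] -/
def heckeSum (N : ℝ) (a : GaussianInt → ℂ) (m : ℤ) : ℂ :=
  ∑ n ∈ normLEStar N, a n * angularCharZ m n

/-- The **ray sums** `a_n' = ∑_{v ∈ ℤ[i]*, N(v) ≤ N, arg v = arg n} a_v` (JT (3.1); Harman's
`c₁(n)`). For `n` primitive the ray `{v : arg v = arg n}` is `{k n : k ∈ ℕ⁺}`.
[cite: JarviniemiTeravainen2024, Lemma 3.2 (3.1)] -/
def rayCoeff (N : ℝ) (a : GaussianInt → ℂ) (n : GaussianInt) : ℂ :=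
  ∑ v ∈ (normLEStar N).filter (fun v : GaussianInt => arg (v : ℂ) = arg (n : ℂ)), a v

/-- **Primitive** Gaussian integers: `n = a + bi` with `(a, b) = 1` (JT after (3.1); Harman
p. 205: "`n = x + iy`, `(x, y) = 1`"). [cite: Harman2007, Lemma 11.1 p. 205] -/
def IsPrimitive (n : GaussianInt) : Prop :=
  Int.gcd n.re n.im = 1

/-- Primitivity is decidable (an equation between natural numbers). [folklore] -/
instance (n : GaussianInt) : Decidable (IsPrimitive n) :=
  inferInstanceAs (Decidable (Int.gcd n.re n.im = 1))

/-- `1` is primitive. [folklore] -/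
theorem isPrimitive_one : IsPrimitive 1 := by
  simp [IsPrimitive]

/-- `1 + i` is primitive. [folklore] -/
theorem isPrimitive_one_add_I : IsPrimitive ⟨1, 1⟩ := by
  simp [IsPrimitive]

/-- A rational integer `k ≥ 2` is not primitive (`gcd(k, 0) = k`). [folklore] -/
theorem not_isPrimitive_intCast {k : ℤ} (hk : 2 ≤ k) : ¬ IsPrimitive (k : GaussianInt) := by
  simp only [IsPrimitive, Zsqrtd.re_intCast, Zsqrtd.im_intCast, Int.gcd_zero_right]
  omega

open Classical in
/-- **Closeness of arguments modulo `π/2`**: `|arg n₁ - arg n₂| ≤ 1/T` in JT's convention that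
`arg` of an element of `ℤ[i]*` is taken modulo `π/2` (JT §1.3; remark after Lemma 3.3: satisfied
"if `i^{k₁} n₁` and `i^{k₂} n₂` lie in the same narrow sector for some integers `k₁, k₂`").
[cite: JarviniemiTeravainen2024, §1.3 and Lemma 3.3] -/
def ArgClose (T : ℝ) (n₁ n₂ : GaussianInt) : Prop :=
  ∃ k : ℤ, |arg (n₁ : ℂ) - arg (n₂ : ℂ) - k * (π / 2)| ≤ 1 / T

/-- `ArgClose` is reflexive when `T > 0`. [folklore] -/
theorem argClose_refl {T : ℝ} (hT : 0 < T) (n : GaussianInt) : ArgClose T n n :=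
  ⟨0, by simp [hT.le]⟩

/-- `ArgClose` is symmetric. [folklore] -/
theorem ArgClose.symm {T : ℝ} {n₁ n₂ : GaussianInt} (h : ArgClose T n₁ n₂) : ArgClose T n₂ n₁ := by
  obtain ⟨k, hk⟩ := h
  refine ⟨-k, ?_⟩
  rw [← abs_neg]
  push_cast
  convert hk using 2
  ring

/-! ### The named facts -/

/-- **Mean value theorem for Hecke polynomials** (Järviniemi–Teräväinen 2024, Lemma 3.2, first
display; = Harman 2007, Lemma 11.1 — "a dual form of the large sieve for `ℤ[i]`", proved in
Harman §A.3 after Coleman — extended from `1 ≤ m ≤ T` to `|m| ≤ T`). There is an absolute `C`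
such that for `N ≥ 1`, `T ≥ 1` and any coefficients `a : ℤ[i]* → ℂ`,
`∑_{|m| ≤ T} |∑_{N(n) ≤ N} a_n λ^m(n)|² ≤ C (N + T) ∑'_{N(n) ≤ N} |a_n'|²`,
where `a_n' = ∑_{N(v) ≤ N, arg v = arg n} a_v` and `∑'` runs over PRIMITIVE `n ∈ ℤ[i]*` only.
Nothing asserted; users take `(h : JarviniemiTeravainen2024_heckeMVT)`.
[cite: JarviniemiTeravainen2024, Lemma 3.2] [cite: Harman2007, Lemma 11.1 p. 205] -/
def JarviniemiTeravainen2024_heckeMVT : Prop :=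
  ∃ C : ℝ, ∀ (N : ℝ) (T : ℕ) (a : GaussianInt → ℂ), 1 ≤ N → 1 ≤ T →
    ∑ m ∈ Icc (-(T : ℤ)) T, ‖heckeSum N a m‖ ^ 2 ≤
      C * (N + T) * ∑ n ∈ (normLEStar N).filter IsPrimitive, ‖rayCoeff N a n‖ ^ 2

open Classical in
/-- **Improved mean value theorem** (Järviniemi–Teräväinen 2024, Lemma 3.3). There is an absolute
`C` such that for `N ≥ 1`, `T ≥ 1` and any coefficients,
`∑_{|m| ≤ T} |∑_{N(n) ≤ N} a_n λ^m(n)|² ≤ C T ∑_{N(n) ≤ N} |a_n|²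
  + C T ∑_{N(n₁), N(n₂) ≤ N, n₁ ≠ n₂, |arg n₁ - arg n₂| ≤ 1/T (mod π/2)} |a_{n₁} a_{n₂}|`
— a gain over Lemma 3.2 for sparse coefficient sequences. (Printed with the typo
"`N(n₂), N(n₂) ≤ N`" for `N(n₁), N(n₂) ≤ N`.) Nothing asserted.
[cite: JarviniemiTeravainen2024, Lemma 3.3] -/
def JarviniemiTeravainen2024_heckeIMVT : Prop :=
  ∃ C : ℝ, ∀ (N : ℝ) (T : ℕ) (a : GaussianInt → ℂ), 1 ≤ N → 1 ≤ T →
    ∑ m ∈ Icc (-(T : ℤ)) T, ‖heckeSum N a m‖ ^ 2 ≤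
      C * T * ∑ n ∈ normLEStar N, ‖a n‖ ^ 2 +
        C * T * ∑ n₁ ∈ normLEStar N, ∑ n₂ ∈ normLEStar N,
          if n₁ ≠ n₂ ∧ ArgClose T n₁ n₂ then ‖a n₁ * a n₂‖ else 0

/-! ### Rays through primitive points, and the ray-sum inequality (proved)

The general companion bound to the mean value theorem — what JT Lemma 3.2 / Harman Lemma 11.2
print as `∑' |a_n'|² ≪ N ∑ |a_n|² τ(n)/N(n)`, which is false (module docstring) — in its correct
form `∑'_{N(n) ≤ N} |a_n'|² ≤ ∑_{N(v) ≤ N} |a_v|² · g(v) √(N/N(v))`, `g(v) = gcd(re v, im v)`,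
proved by Cauchy–Schwarz along the rays `{k n : k ∈ ℕ⁺}` of the primitive points `n`. -/

section Ray

/-- The **content** `g(v) = gcd(re v, im v)` of a Gaussian integer (`v = g(v) · v₀` with `v₀`
primitive). [folklore] -/
def content (v : GaussianInt) : ℕ :=
  Int.gcd v.re v.im

/-- `v` is primitive iff its content is `1`. [folklore] -/
theorem isPrimitive_iff_content {v : GaussianInt} : IsPrimitive v ↔ content v = 1 := Iff.rfl

/-- The content of `k · n` is `k` times the content of `n`. [folklore] -/
theorem content_natCast_mul (k : ℕ) (n : GaussianInt) :
    content ((k : GaussianInt) * n) = k * content n := by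
  have h : ((k : GaussianInt) * n) = ⟨(k : ℤ) * n.re, (k : ℤ) * n.im⟩ := by
    rw [show ((k : GaussianInt)) = ((k : ℤ) : GaussianInt) by simp, Zsqrtd.intCast_val]
    ext <;> simp
  rw [content, content, h]
  simp [Int.gcd_mul_left]

/-- Real and imaginary parts of `k · n`. [folklore] -/
theorem natCast_mul_re_im (k : ℕ) (n : GaussianInt) :
    ((k : GaussianInt) * n).re = (k : ℤ) * n.re ∧ ((k : GaussianInt) * n).im = (k : ℤ) * n.im := by
  rw [show ((k : GaussianInt)) = ((k : ℤ) : GaussianInt) by simp, Zsqrtd.intCast_val]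
  constructor <;> simp

/-- The norm of `k · n` is `k² N(n)`. [folklore] -/
theorem norm_natCast_mul (k : ℕ) (n : GaussianInt) :
    ((k : GaussianInt) * n).norm = (k : ℤ) ^ 2 * n.norm := by
  rw [Zsqrtd.norm_mul, show ((k : GaussianInt)) = ((k : ℤ) : GaussianInt) by simp,
    Zsqrtd.norm_intCast]
  ring

/-- A positive integer multiple of an element of `ℤ[i]*` lies in `ℤ[i]*`. [folklore] -/
theorem natCast_mul_mem_firstQuadrant {k : ℕ} (hk : 0 < k) {n : GaussianInt}
    (hn : n ∈ firstQuadrant) : (k : GaussianInt) * n ∈ firstQuadrant := by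
  obtain ⟨hre, him⟩ := natCast_mul_re_im k n
  rw [mem_firstQuadrant, hre, him]
  have hk' : (0 : ℤ) < k := by exact_mod_cast hk
  exact ⟨mul_pos hk' hn.1, mul_nonneg hk'.le hn.2⟩

/-- The norm of an element of `ℤ[i]*` is positive. [folklore] -/
theorem norm_pos_of_mem_firstQuadrant {n : GaussianInt} (hn : n ∈ firstQuadrant) :
    0 < n.norm :=
  GaussianInt.norm_pos.2 (ne_zero_of_mem_firstQuadrant hn)

/-- **The ray lemma.** If `n ∈ ℤ[i]*` is primitive and `v ∈ ℤ[i]*` has the same argument, then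
`v = k · n` for a positive integer `k` (equal arguments give `v = t n` with `t = |v|/|n| > 0`;
`t re n, t im n ∈ ℤ` and a Bézout relation `x re n + y im n = 1` give `t ∈ ℤ`). [folklore] -/
theorem eq_natCast_mul_of_arg_eq {n v : GaussianInt} (hn : n ∈ firstQuadrant)
    (hp : IsPrimitive n) (hv : v ∈ firstQuadrant) (harg : arg (v : ℂ) = arg (n : ℂ)) :
    ∃ k : ℕ, 0 < k ∧ v = (k : GaussianInt) * n := by
  have hn0 : (n : ℂ) ≠ 0 := by
    rw [Ne, GaussianInt.toComplex_eq_zero]; exact ne_zero_of_mem_firstQuadrant hn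
  have hv0 : (v : ℂ) ≠ 0 := by
    rw [Ne, GaussianInt.toComplex_eq_zero]; exact ne_zero_of_mem_firstQuadrant hv
  -- `v = t • n`, `t = ‖v‖ / ‖n‖ > 0`
  set t : ℝ := ‖(v : ℂ)‖ / ‖(n : ℂ)‖ with ht_def
  have htpos : 0 < t := div_pos (norm_pos_iff.2 hv0) (norm_pos_iff.2 hn0)
  have htn : (t : ℂ) * (n : ℂ) = v := by
    have h := (Complex.arg_eq_arg_iff hn0 hv0).1 harg.symm
    rwa [← Complex.ofReal_div] at h
  have hre : t * (n.re : ℝ) = (v.re : ℝ) := by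
    have h := congrArg Complex.re htn
    rw [Complex.re_ofReal_mul] at h
    rwa [GaussianInt.intCast_re, GaussianInt.intCast_re]
  have him : t * (n.im : ℝ) = (v.im : ℝ) := by
    have h := congrArg Complex.im htn
    rw [Complex.im_ofReal_mul] at h
    rwa [GaussianInt.intCast_im, GaussianInt.intCast_im]
  -- Bézout: `re n · A + im n · B = 1`, hence `t = re v · A + im v · B ∈ ℤ`
  have hbez : (n.re : ℝ) * Int.gcdA n.re n.im + (n.im : ℝ) * Int.gcdB n.re n.im = 1 := by
    have h := Int.gcd_eq_gcd_ab n.re n.im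
    rw [show Int.gcd n.re n.im = 1 from hp] at h
    exact_mod_cast h.symm
  set K : ℤ := v.re * Int.gcdA n.re n.im + v.im * Int.gcdB n.re n.im with hK
  have htK : t = (K : ℝ) := by
    calc t = t * ((n.re : ℝ) * Int.gcdA n.re n.im + (n.im : ℝ) * Int.gcdB n.re n.im) := by
          rw [hbez, mul_one]
      _ = t * (n.re : ℝ) * Int.gcdA n.re n.im + t * (n.im : ℝ) * Int.gcdB n.re n.im := by ring
      _ = (K : ℝ) := by rw [hre, him, hK]; push_cast; ring
  have hKpos : 0 < K := by
    have : (0 : ℝ) < K := htK ▸ htpos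
    exact_mod_cast this
  refine ⟨K.toNat, by omega, ?_⟩
  have hKnat : ((K.toNat : ℕ) : ℤ) = K := Int.toNat_of_nonneg hKpos.le
  obtain ⟨hre', him'⟩ := natCast_mul_re_im K.toNat n
  ext
  · rw [hre', hKnat]
    have : (v.re : ℝ) = ((K * n.re : ℤ) : ℝ) := by rw [← hre, htK]; push_cast; ring
    exact_mod_cast this
  · rw [him', hKnat]
    have : (v.im : ℝ) = ((K * n.im : ℤ) : ℝ) := by rw [← him, htK]; push_cast; ring
    exact_mod_cast this

/-- Conversely, positive integer multiples keep the argument. [folklore] -/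
theorem arg_natCast_mul {k : ℕ} (hk : 0 < k) (n : GaussianInt) :
    arg (((k : GaussianInt) * n : GaussianInt) : ℂ) = arg (n : ℂ) := by
  rw [GaussianInt.toComplex_mul, show (((k : GaussianInt)) : ℂ) = ((k : ℝ) : ℂ) by simp]
  exact Complex.arg_real_mul _ (by exact_mod_cast hk)

/-- Two primitive elements of `ℤ[i]*` with the same argument are equal. [folklore] -/
theorem eq_of_isPrimitive_of_arg_eq {n₁ n₂ : GaussianInt} (h₁ : n₁ ∈ firstQuadrant)
    (hp₁ : IsPrimitive n₁) (h₂ : n₂ ∈ firstQuadrant) (hp₂ : IsPrimitive n₂)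
    (harg : arg (n₁ : ℂ) = arg (n₂ : ℂ)) : n₁ = n₂ := by
  obtain ⟨k, hk, rfl⟩ := eq_natCast_mul_of_arg_eq h₂ hp₂ h₁ harg
  have hc : content ((k : GaussianInt) * n₂) = k * content n₂ := content_natCast_mul k n₂
  rw [isPrimitive_iff_content] at hp₁ hp₂
  rw [hp₁, hp₂, mul_one] at hc
  rw [← hc]; simp

/-- The ray of `n` inside `{v ∈ ℤ[i]* : N(v) ≤ N}`: the index set of `a_n'` (`rayCoeff`). [folklore] -/
def rayStar (N : ℝ) (n : GaussianInt) : Finset GaussianInt :=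
  (normLEStar N).filter (fun v : GaussianInt => arg (v : ℂ) = arg (n : ℂ))

/-- `a_n'` is the sum of `a` over the ray of `n`. [folklore] -/
theorem rayCoeff_eq_sum_rayStar (N : ℝ) (a : GaussianInt → ℂ) (n : GaussianInt) :
    rayCoeff N a n = ∑ v ∈ rayStar N n, a v := rfl

/-- Membership in the ray finset. [folklore] -/
theorem mem_rayStar {N : ℝ} {n v : GaussianInt} :
    v ∈ rayStar N n ↔ v ∈ normLEStar N ∧ arg (v : ℂ) = arg (n : ℂ) := by
  simp [rayStar]

/-- **Ray count.** For primitive `n ∈ ℤ[i]*`, the ray `{v ∈ ℤ[i]* : N(v) ≤ N, arg v = arg n}`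
is contained in `{k n : 1 ≤ k ≤ ⌊√(N/N(n))⌋}`, so it has at most `√(N / N(n))` elements. [folklore] -/
theorem card_rayStar_le {N : ℝ} {n : GaussianInt} (hn : n ∈ firstQuadrant) (hp : IsPrimitive n) :
    ((rayStar N n).card : ℝ) ≤ Real.sqrt (N / n.norm) := by
  set K : ℕ := ⌊Real.sqrt (N / n.norm)⌋₊ with hK
  have hNn : (0 : ℝ) < n.norm := by exact_mod_cast norm_pos_of_mem_firstQuadrant hn
  have hsub : rayStar N n ⊆ (Finset.Icc 1 K).image (fun k : ℕ => (k : GaussianInt) * n) := by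
    intro v hv
    rw [mem_rayStar, mem_normLEStar] at hv
    obtain ⟨⟨hvN, hvq⟩, hva⟩ := hv
    obtain ⟨k, hk, rfl⟩ := eq_natCast_mul_of_arg_eq hn hp hvq hva
    refine Finset.mem_image.2 ⟨k, Finset.mem_Icc.2 ⟨hk, ?_⟩, rfl⟩
    -- `k² N(n) ≤ N` gives `k ≤ √(N/N(n))`
    rw [norm_natCast_mul] at hvN
    push_cast at hvN
    refine Nat.le_floor ?_
    refine Real.le_sqrt_of_sq_le ?_
    rw [le_div_iff₀ hNn]
    linarith
  calc ((rayStar N n).card : ℝ)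
      ≤ (((Finset.Icc 1 K).image (fun k : ℕ => (k : GaussianInt) * n)).card : ℝ) := by
        exact_mod_cast Finset.card_le_card hsub
    _ ≤ ((Finset.Icc 1 K).card : ℝ) := by exact_mod_cast Finset.card_image_le
    _ = K := by simp
    _ ≤ Real.sqrt (N / n.norm) := Nat.floor_le (Real.sqrt_nonneg _)

/-- Cauchy–Schwarz on one ray: `|a_n'|² ≤ √(N/N(n)) · ∑_{v on the ray} |a_v|²` for primitive
`n ∈ ℤ[i]*`. [folklore] -/
theorem norm_rayCoeff_sq_le {N : ℝ} (a : GaussianInt → ℂ) {n : GaussianInt}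
    (hn : n ∈ firstQuadrant) (hp : IsPrimitive n) :
    ‖rayCoeff N a n‖ ^ 2 ≤ Real.sqrt (N / n.norm) * ∑ v ∈ rayStar N n, ‖a v‖ ^ 2 := by
  rw [rayCoeff_eq_sum_rayStar]
  have hS : 0 ≤ ∑ v ∈ rayStar N n, ‖a v‖ ^ 2 := sum_nonneg fun _ _ ↦ by positivity
  calc ‖∑ v ∈ rayStar N n, a v‖ ^ 2
      ≤ (∑ v ∈ rayStar N n, ‖a v‖) ^ 2 := by
        gcongr
        exact norm_sum_le _ _
    _ ≤ (rayStar N n).card * ∑ v ∈ rayStar N n, ‖a v‖ ^ 2 := sq_sum_le_card_mul_sum_sq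
    _ ≤ Real.sqrt (N / n.norm) * ∑ v ∈ rayStar N n, ‖a v‖ ^ 2 := by
        gcongr
        exact card_rayStar_le hn hp

/-- For `v = k · n` on the ray of a primitive `n`, `√(N/N(n)) = g(v) √(N/N(v))` — the weight
of the ray-sum inequality seen from `v`. [folklore] -/
theorem sqrt_div_norm_eq_content_mul {N : ℝ} {n v : GaussianInt} (hn : n ∈ firstQuadrant)
    (hp : IsPrimitive n) (hv : v ∈ firstQuadrant) (harg : arg (v : ℂ) = arg (n : ℂ)) :
    Real.sqrt (N / n.norm) = content v * Real.sqrt (N / v.norm) := by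
  obtain ⟨k, hk, rfl⟩ := eq_natCast_mul_of_arg_eq hn hp hv harg
  rw [content_natCast_mul, (isPrimitive_iff_content).1 hp, mul_one, norm_natCast_mul]
  have hNn : (0 : ℝ) < n.norm := by exact_mod_cast norm_pos_of_mem_firstQuadrant hn
  have hk' : (0 : ℝ) < k := by exact_mod_cast hk
  push_cast
  rw [mul_comm ((k : ℝ) ^ 2) _, ← div_div, Real.sqrt_div' (N / (n.norm : ℝ)) (sq_nonneg (k : ℝ)),
    Real.sqrt_sq hk'.le, mul_div_cancel₀ _ hk'.ne']

/-- **The ray-sum inequality** (the correct general form of the second display of JT Lemma 3.2 /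
the first display of Harman Lemma 11.2): for every `N` and all coefficients,
`∑'_{n ∈ ℤ[i]* primitive, N(n) ≤ N} |a_n'|² ≤ ∑_{v ∈ ℤ[i]*, N(v) ≤ N} |a_v|² · g(v) √(N / N(v))`,
`g(v) = gcd(re v, im v)`. (For `v` primitive the weight is `√(N/N(v)) ≤ N/N(v)`; in general it
can be as large as `√N`, attained on the real axis — the source of the misprint.) PROVED. [folklore] -/
theorem sum_norm_rayCoeff_sq_le (N : ℝ) (a : GaussianInt → ℂ) :
    ∑ n ∈ (normLEStar N).filter IsPrimitive, ‖rayCoeff N a n‖ ^ 2 ≤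
      ∑ v ∈ normLEStar N, ‖a v‖ ^ 2 * (content v * Real.sqrt (N / v.norm)) := by
  classical
  set P := (normLEStar N).filter IsPrimitive with hP
  -- Step 1: Cauchy–Schwarz on each ray
  have h1 : ∑ n ∈ P, ‖rayCoeff N a n‖ ^ 2 ≤
      ∑ n ∈ P, Real.sqrt (N / n.norm) * ∑ v ∈ rayStar N n, ‖a v‖ ^ 2 := by
    refine sum_le_sum fun n hn ↦ ?_
    rw [hP, mem_filter, mem_normLEStar] at hn
    exact norm_rayCoeff_sq_le a hn.1.2 hn.2
  refine h1.trans ?_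
  -- Step 2: write the ray sums as filtered sums over `normLEStar N` and swap
  have h2 : ∀ n ∈ P, Real.sqrt (N / n.norm) * ∑ v ∈ rayStar N n, ‖a v‖ ^ 2 =
      ∑ v ∈ normLEStar N,
        if arg (v : ℂ) = arg (n : ℂ) then Real.sqrt (N / n.norm) * ‖a v‖ ^ 2 else 0 := by
    intro n _
    rw [rayStar, sum_filter, mul_sum]
    refine sum_congr rfl fun v _ ↦ ?_
    split_ifs <;> simp
  rw [sum_congr rfl h2, sum_comm]
  -- Step 3: for fixed `v`, at most one primitive `n` has `arg v = arg n`, with the right weight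
  refine sum_le_sum fun v hv ↦ ?_
  rw [mem_normLEStar] at hv
  rw [← sum_filter]
  set S := P.filter (fun n : GaussianInt => arg (v : ℂ) = arg (n : ℂ)) with hS
  have hcard : S.card ≤ 1 := by
    refine Finset.card_le_one.2 fun n₁ h₁ n₂ h₂ ↦ ?_
    rw [hS, mem_filter, hP, mem_filter, mem_normLEStar] at h₁ h₂
    exact eq_of_isPrimitive_of_arg_eq h₁.1.1.2 h₁.1.2 h₂.1.1.2 h₂.1.2 (h₁.2.symm.trans h₂.2)
  have hval : ∀ n ∈ S, Real.sqrt (N / n.norm) * ‖a v‖ ^ 2 =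
      ‖a v‖ ^ 2 * (content v * Real.sqrt (N / v.norm)) := by
    intro n hn
    rw [hS, mem_filter, hP, mem_filter, mem_normLEStar] at hn
    rw [sqrt_div_norm_eq_content_mul hn.1.1.2 hn.1.2 hv.2 hn.2, mul_comm]
  rw [sum_congr rfl hval, sum_const, nsmul_eq_mul]
  have h0 : 0 ≤ ‖a v‖ ^ 2 * (content v * Real.sqrt (N / v.norm)) := by positivity
  calc (S.card : ℝ) * (‖a v‖ ^ 2 * (content v * Real.sqrt (N / v.norm)))
      ≤ 1 * (‖a v‖ ^ 2 * (content v * Real.sqrt (N / v.norm))) := by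
        gcongr
        exact_mod_cast hcard
    _ = _ := one_mul _

/-- The special case of PRIMITIVE-supported coefficients (content `1` wherever `a_v ≠ 0`), in
which the printed bound does hold, even without the divisor function:
`∑' |a_n'|² ≤ ∑ |a_v|² √(N/N(v))`. PROVED. [folklore] -/
theorem sum_norm_rayCoeff_sq_le_of_primitive (N : ℝ) (a : GaussianInt → ℂ)
    (ha : ∀ v ∈ firstQuadrant, a v ≠ 0 → IsPrimitive v) :
    ∑ n ∈ (normLEStar N).filter IsPrimitive, ‖rayCoeff N a n‖ ^ 2 ≤
      ∑ v ∈ normLEStar N, ‖a v‖ ^ 2 * Real.sqrt (N / v.norm) := by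
  refine (sum_norm_rayCoeff_sq_le N a).trans (sum_le_sum fun v hv ↦ ?_)
  rw [mem_normLEStar] at hv
  by_cases h0 : a v = 0
  · simp [h0]
  · rw [(isPrimitive_iff_content).1 (ha v hv.2 h0)]
    simp

end Ray

/-! ### Proved consequences of the mean value theorem -/

/-- **The mean value theorem with the ray-sum inequality applied**:
`∑_{|m| ≤ T} |F(m)|² ≤ C (N + T) ∑_{N(v) ≤ N} |a_v|² g(v) √(N/N(v))`. PROVED from the named
fact and `sum_norm_rayCoeff_sq_le`. [cite: JarviniemiTeravainen2024, Lemma 3.2] -/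
theorem JarviniemiTeravainen2024_heckeMVT.le_content_weighted
    (h : JarviniemiTeravainen2024_heckeMVT) :
    ∃ C : ℝ, 0 ≤ C ∧ ∀ (N : ℝ) (T : ℕ) (a : GaussianInt → ℂ), 1 ≤ N → 1 ≤ T →
      ∑ m ∈ Icc (-(T : ℤ)) T, ‖heckeSum N a m‖ ^ 2 ≤
        C * (N + T) * ∑ v ∈ normLEStar N, ‖a v‖ ^ 2 * (content v * Real.sqrt (N / v.norm)) := by
  obtain ⟨C, hC⟩ := h
  refine ⟨max C 0, le_max_right _ _, fun N T a hN hT ↦ ?_⟩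
  have hNT : 0 ≤ N + T := by positivity
  have hS : 0 ≤ ∑ n ∈ (normLEStar N).filter IsPrimitive, ‖rayCoeff N a n‖ ^ 2 :=
    sum_nonneg fun _ _ ↦ by positivity
  calc ∑ m ∈ Icc (-(T : ℤ)) T, ‖heckeSum N a m‖ ^ 2
      ≤ C * (N + T) * ∑ n ∈ (normLEStar N).filter IsPrimitive, ‖rayCoeff N a n‖ ^ 2 :=
        hC N T a hN hT
    _ ≤ max C 0 * (N + T) * ∑ n ∈ (normLEStar N).filter IsPrimitive, ‖rayCoeff N a n‖ ^ 2 := by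
        gcongr; exact le_max_left _ _
    _ ≤ max C 0 * (N + T) *
          ∑ v ∈ normLEStar N, ‖a v‖ ^ 2 * (content v * Real.sqrt (N / v.norm)) :=
        mul_le_mul_of_nonneg_left (sum_norm_rayCoeff_sq_le N a)
          (mul_nonneg (le_max_right _ _) hNT)

/-- The mean value theorem at a single (the trivial) character is already informative: for
`T ≥ 1` the `m = 0` term gives `|∑_{N(n) ≤ N} a_n|² ≤ C (N + T) ∑' |a_n'|²`. PROVED from the
named fact (drop the other terms). [cite: JarviniemiTeravainen2024, Lemma 3.2] -/
theorem JarviniemiTeravainen2024_heckeMVT.sum_sq_le (h : JarviniemiTeravainen2024_heckeMVT) :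
    ∃ C : ℝ, ∀ (N : ℝ) (T : ℕ) (a : GaussianInt → ℂ), 1 ≤ N → 1 ≤ T →
      ‖∑ n ∈ normLEStar N, a n‖ ^ 2 ≤
        C * (N + T) * ∑ n ∈ (normLEStar N).filter IsPrimitive, ‖rayCoeff N a n‖ ^ 2 := by
  obtain ⟨C, hC⟩ := h
  refine ⟨C, fun N T a hN hT ↦ le_trans ?_ (hC N T a hN hT)⟩
  have h0 : (0 : ℤ) ∈ Icc (-(T : ℤ)) T := by simp
  have hterm : ‖∑ n ∈ normLEStar N, a n‖ ^ 2 = ‖heckeSum N a 0‖ ^ 2 := by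
    simp [heckeSum]
  rw [hterm]
  exact single_le_sum (f := fun m ↦ ‖heckeSum N a m‖ ^ 2) (fun _ _ ↦ by positivity) h0

end Literature.NumberTheory.LFunctions.GaussianInt

end
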